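import Summits.ResolutionOfSingularities.ResolutionOfSingularities.Theorems.WildConesCampaignW46HypersurfacesCharTwoIsolTransferLeaf
import Summits.ResolutionOfSingularities.ResolutionOfSingularities.Theorems.WildConesCampaignW46HypersurfacesCharTwoTangentCone

/-!
# [OURS · L1 W4.6, rung (ii) at p = 2, EVERY dimension n] THE CASE `e = 2` DECIDED: an isolated double
# point with a tangent cubic (`h₂ ≤ 2`) has ISOLATED double successors; with gen 3's trichotomy, THE
# COMPLETE ONE-STEP CRITERION — the next double point of an isolated double point `z² = a(u₁,…,uₙ)`
# is isolated iff `e ≤ 1`, or `e = 2` and `h₂ ≤ 2` (every field of characteristic 2)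

HONEST FRAMING. Everything here is OURS: theorems about route WildCones' own TYPED point-blow-up
dynamics (`Theorems/WildConesClassicalRegimesDefs.lean`: states `c : (Fin n → ℕ) → κ` = coefficients of
`a(u₁,…,uₙ)` in `z² = a`; `step i τ c` = blow up the point, chart `u_i`, translate by `τ`, delete
squares; `MultP` = cleaned order `≥ 2` (a double point), `Isol` = finite Milnor algebra `κ⟦u⟧/(∂a)`,
`mu` = its dimension) and the invariants `milnorEmbDim = e` (p498937: embedding dimension of the Milnor
algebra `A`, the corank of the polar form) and `milnorHilbertTwo = h₂` (p511581: `dim_κ 𝔪_A²/𝔪_A³`).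
Nothing here is a statement of H. Hironaka's manuscript [Hironaka2017] and nothing of it is used; no
FACT-LIST premise. AI review is weaker than expert review. Cell res-hironaka (LADDER-RESOLUTION rung L,
D-0089), slot W4.6 «restricted regimes as rungs», seat res-L1-s46-pv-4 (gen 4): «(ii) THREEFOLD
HYPERSURFACES, second prover: the p = 2 hyperbolic-splitting regime of `ClassicalRegimes` (n ≥ 3,
order-2 cleaned states)». Host route `WildCones`, crux `ClassicalRegimes`
(stmt-ResolutionOfSingularities-16884, proved); `--supports` that item as a helper.

WHAT IS HERE (fourth file of the gen-4 package «the case `e = 2`»):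

* `surface_isol_transfer_any`, `formal_isol_transfer` — the surface leaf of
  `…IsolTransferLeaf.lean` in either chart (swap of the two variables) and the descent along the
  hyperbolic pairs (strong induction on `n`, the tree's `exists_pair_ne` / `descent_step`; invariance
  of `jetTwoColength`, `jetThreeColength` and of finiteness under the `κ`-isomorphisms of Milnor
  algebras): for `X_i² G = a∘Φ_{i,τ}` with `a` ISOLATED of embedding dimension two and
  `jetThreeColength a ≤ 5`, the Milnor algebra of `G` is finite.
* `hypersurface_isol_step_of_milnorHilbertTwo_le_two` — **STATES: an ISOLATED double point with `e = 2`
  and `h₂ ≤ 2` (the residual plane germ HAS a tangent cubic) has only ISOLATED double successors**, and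
  the Milnor number drops (the crux's `muDrop_two`).
* `hypersurface_isol_step_iff_of_milnorEmbDim_eq_two` — with `…TangentCone.lean`'s `h₂ = 3` theorem:
  for an isolated double state with `e = 2` and a double successor, **successor isolated ⇔ `h₂ ≤ 2`**.
* `hypersurface_isol_step_iff` — **THE COMPLETE ONE-STEP CRITERION** (with gen 3's
  `hypersurface_trichotomy`, p501990): for an ISOLATED double state of `z² = a(u₁,…,uₙ)` over any field
  of characteristic `2` and any chart/translation whose successor is a double point:
  **successor isolated ⇔ `e(c) ≤ 1 ∨ (e(c) = 2 ∧ h₂(c) ≤ 2)`** — the first two values of the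
  Hilbert function of the Milnor algebra decide it; the case gen 3 left open (`e = 2`: «decides
  nothing», p507619) is decided by `h₂`.

NOT HERE: the classes `(e, h₂) = (2, 1)` and `(2, 3)` are analysed finely in `…TangentCone.lean`
(resolved in two blow-ups / non-isolated successors); the middle class `(2, 2)` (tangent cubic with a
multiple root) is NOT closed under the dynamics and is not claimed to terminate here.

References: E. Casas-Alvero, Singularities of Plane Curves, §3 (context); G.-M. Greuel, G. Pfister,
The splitting lemma in any characteristic, J. Algebra 689 (2026) = arXiv:2507.17078 [GreuelPfister2026]
(through the tree's `pair_reduction`, `descent_step`); H. Hironaka, ms. 2017-03-23 [Hironaka2017],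
Th. 16.6 p.84, Th. 16.13 p.87 — quoted for the ROLE replaced only, under adjudication, never as fact.
-/

noncomputable section

-- single-problem summit: the doubled namespace component `ResolutionOfSingularities` is forced
set_option linter.dupNamespace false

open scoped BigOperators Classical

open MvPowerSeries IsLocalRing

open Literature.AlgebraicGeometry.Resolution

namespace Summit.ResolutionOfSingularities.ResolutionOfSingularities.Theorems

namespace CampaignW46.HypersurfacesCharTwo

open WildCones WildCones.MuDropCharTwoOrdP ThreefoldsCharTwo

variable {κ : Type} [Field κ]

/-! ## The surface leaf in either chart -/

/-- [OURS · L1 W4.6] **ISOLATEDNESS TRANSFER, THE SURFACE LEAF, either chart**: `surface_isol_transfer`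
after renaming the two variables when the chart index is `1`. [folklore] -/
theorem surface_isol_transfer_any [CharP κ 2] (i : Fin 2) (τ : Fin 2 → κ)
    {a G : MvPowerSeries (Fin 2) κ} (ha : 2 ≤ a.order)
    (hnopair : coeff (Finsupp.single 0 1 + Finsupp.single 1 1) a = 0)
    (hG : X i ^ 2 * G = subst (fun s => if s = i then (X i : MvPowerSeries (Fin 2) κ)
      else X i * (X s + C (τ s))) a)
    (hfa : Module.Finite κ (MvPowerSeries (Fin 2) κ ⧸
      Ideal.span (Set.range fun s => MvPowerSeries.pderiv s a)))
    (h5 : jetThreeColength a ≤ 5) :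
    Module.Finite κ (MvPowerSeries (Fin 2) κ ⧸
      Ideal.span (Set.range fun s => MvPowerSeries.pderiv s G)) := by
  by_cases hi : i = 0
  · subst hi
    exact surface_isol_transfer τ ha hnopair hG hfa h5
  · have hi1 : i = 1 := by
      fin_cases i
      · exact absurd rfl hi
      · rfl
    subst hi1
    -- rename by the transposition `w = (0 1)`
    set w : Fin 2 ≃ Fin 2 := Equiv.swap 0 1 with hw
    have hw1 : w 1 = 0 := by rw [hw, Equiv.swap_apply_right]
    have hw0 : w 0 = 1 := by rw [hw, Equiv.swap_apply_left]
    obtain ⟨εa⟩ := milnorAlg_equiv_rename w a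
    obtain ⟨εG⟩ := milnorAlg_equiv_rename w G
    haveI hfa' : Module.Finite κ (MvPowerSeries (Fin 2) κ ⧸
        Ideal.span (Set.range fun s => MvPowerSeries.pderiv s (rename w a))) :=
      Module.Finite.equiv εa.toLinearEquiv
    have hG' : X (0 : Fin 2) ^ 2 * rename w G = subst (fun s => if s = (0 : Fin 2) then
        (X 0 : MvPowerSeries (Fin 2) κ) else X 0 * (X s + C ((fun t => τ (w.symm t)) s)))
        (rename w a) := by
      have h := congrArg (rename w) hG
      rw [map_mul, map_pow, rename_X, hw1, rename_subst_blowFam, hw1] at h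
      exact h
    have ha' : 2 ≤ (rename w a).order := by
      have := le_order_algEquiv (renameEquiv κ w) ha
      rwa [renameEquiv_apply] at this
    have hnopair' : coeff (Finsupp.single 0 1 + Finsupp.single 1 1) (rename w a) = 0 := by
      have h := coeff_pair_rename w 1 0 a
      rw [hw1, hw0] at h
      rw [h, add_comm, hnopair]
    have h5' : jetThreeColength (rename w a) ≤ 5 := by
      rw [← jetThreeColength_eq_of_equiv εa]; exact h5
    haveI := surface_isol_transfer (fun t => τ (w.symm t)) ha' hnopair' hG' hfa' h5'
    exact Module.Finite.equiv εG.symm.toLinearEquiv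

/-! ## The descent: the formal isolatedness transfer -/

/-- [OURS · L1 W4.6] **THE FORMAL ISOLATEDNESS TRANSFER** (characteristic two, every `n`): let
`X_i² G = a∘Φ_{i,τ}` (`ord a ≥ 2`, `G` without linear terms) with `a` of embedding dimension two
(`jetTwoColength a = 3`), `jetThreeColength a ≤ 5` (a tangent cubic: not both residual polars in
`𝔪³`) and FINITE Milnor algebra. Then the Milnor algebra of `G` is finite. Strong induction on `n`
along the tree's `descent_step` (a hyperbolic pair away from the chart index, `exists_pair_ne`), down to
the surface leaf `surface_isol_transfer_any`. [cite: GreuelPfister2026, Thm 3.5 and Cor 3.7] -/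
theorem formal_isol_transfer [CharP κ 2] : ∀ (n : ℕ) (i : Fin n) (τ : Fin n → κ)
    (a G : MvPowerSeries (Fin n) κ), 2 ≤ a.order → (∀ s, coeff (Finsupp.single s 1) G = 0) →
    X i ^ 2 * G = subst (fun s => if s = i then (X i : MvPowerSeries (Fin n) κ)
      else X i * (X s + C (τ s))) a → jetTwoColength a = 3 → jetThreeColength a ≤ 5 →
    Module.Finite κ (MvPowerSeries (Fin n) κ ⧸
      Ideal.span (Set.range fun s => MvPowerSeries.pderiv s a)) →
    Module.Finite κ (MvPowerSeries (Fin n) κ ⧸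
      Ideal.span (Set.range fun s => MvPowerSeries.pderiv s G)) := by
  intro n
  induction n using Nat.strong_induction_on with
  | _ n ih =>
  intro i τ a G ha hG0 hG h3 h5 hfa
  by_cases hpair : ∃ j l : Fin n, j ≠ l ∧ coeff (Finsupp.single j 1 + Finsupp.single l 1) a ≠ 0
  · obtain ⟨j, l, hjl, hj, hl, hq⟩ := exists_pair_ne i τ ha hG hG0 hpair
    obtain ⟨e, i', he, hi', -⟩ := exists_compl_embedding hjl (Ne.symm hj) (Ne.symm hl)
    obtain ⟨a', G', ha', hG0', hG', ⟨εa⟩, ⟨εG⟩⟩ :=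
      descent_step i τ ha hG0 hG hjl hj hl hq e he i' hi'
    have hlt : n - 2 < n := by
      have := Fin.pos i
      omega
    have h2a : jetTwoColength a = jetTwoColength a' := jetTwoColength_eq_of_equiv εa
    have h3a : jetThreeColength a = jetThreeColength a' := jetThreeColength_eq_of_equiv εa
    haveI := hfa
    haveI := ih (n - 2) hlt i' (fun t => τ (e t)) a' G' ha' hG0' hG' (by rw [← h2a, h3])
      (by rw [← h3a]; exact h5) (Module.Finite.equiv εa.toLinearEquiv)
    exact Module.Finite.equiv εG.symm.toLinearEquiv
  · push Not at hpair
    have ha' := (FormalCoordChange.two_le_order_iff a).mp ha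
    have hcol : jetTwoColength a = n + 1 := jetTwoColength_of_no_pair ha'.2 hpair
    have hn : n = 2 := by omega
    subst hn
    exact surface_isol_transfer_any i τ ha (hpair 0 1 (by decide)) hG hfa h5

/-! ## States: the case `e = 2` decided for isolated double points -/

section States

variable {n : ℕ}

/-- [OURS · L1 W4.6 rung (ii) at `p = 2`, every dimension; NOT a statement of the manuscript]
**AN ISOLATED DOUBLE POINT WITH `e = 2` AND A TANGENT CUBIC (`h₂ ≤ 2`) HAS ONLY ISOLATED DOUBLE
SUCCESSORS, and the Milnor number drops** (hypersurface double points `z² = a(u₁,…,uₙ)`, any field of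
characteristic `2`, any `n`, any chart `i`, any translation `τ`): if `c` is isolated of multiplicity
two with `e(c) = 2` (polar form of corank two) and `h₂(c) ≤ 2` (after splitting the hyperbolic pairs,
the residual plane germ has order exactly `3` modulo squares), and `step i τ c` is again a double
point, then it is an ISOLATED double point and `μ(step i τ c) < μ(c)`. The drop is the crux's
`muDrop_two`; isolatedness is `formal_isol_transfer`. [cite: GreuelPfister2026, Thm 3.5 and Cor 3.7] -/
theorem hypersurface_isol_step_of_milnorHilbertTwo_le_two [CharP κ 2] (c : (Fin n → ℕ) → κ)
    (i : Fin n) (τ : Fin n → κ) (hM : MultP 2 n κ c) (hI : Isol 2 n κ c)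
    (he : milnorEmbDim 2 n κ c = 2) (hh : milnorHilbertTwo 2 n κ c ≤ 2)
    (hM' : MultP 2 n κ (step 2 n κ i τ c)) :
    Isol 2 n κ (step 2 n κ i τ c) ∧ mu 2 n κ (step 2 n κ i τ c) < mu 2 n κ c := by
  obtain ⟨G, ha, hG0, hG, hj, hj'⟩ := dictCharTwo c i τ hM hM'
  have hcol := (milnorEmbDim_le_and_mod_two hM).2.2
  have hr := milnorHilbertTwo_range hM he
  have hfa : Module.Finite κ (MvPowerSeries (Fin n) κ ⧸
      Ideal.span (Set.range fun s => MvPowerSeries.pderiv s (ser 2 n κ c))) := by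
    rw [← hj]; exact hI
  have hfG := formal_isol_transfer n i τ (ser 2 n κ c) G ha hG0 hG (by rw [hcol, he])
    (by rw [hr.2.2]; omega) hfa
  have hI' : Isol 2 n κ (step 2 n κ i τ c) := by
    change Module.Finite κ (MvPowerSeries (Fin n) κ ⧸ jac 2 n κ (step 2 n κ i τ c))
    rw [hj']
    exact hfG
  exact ⟨hI', muDrop_two n κ c i τ hI hM hI' hM'⟩

/-- [OURS · L1 W4.6 rung (ii) at `p = 2`, every dimension; NOT a statement of the manuscript]
**THE CASE `e = 2` DECIDED**: for an ISOLATED double state `c` of `z² = a(u₁,…,uₙ)` (any field of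
characteristic `2`) with `e(c) = 2` and a chart/translation whose successor is a double point, the
successor is isolated **iff `h₂(c) ≤ 2`** (iff the residual plane germ has a tangent cubic).
(`⇐`: `hypersurface_isol_step_of_milnorHilbertTwo_le_two`; `⇒`: `h₂ = 3` forces a non-isolated
successor, `hypersurface_not_isol_step_of_milnorHilbertTwo_eq_three`.) [folklore] -/
theorem hypersurface_isol_step_iff_of_milnorEmbDim_eq_two [CharP κ 2] (c : (Fin n → ℕ) → κ)
    (i : Fin n) (τ : Fin n → κ) (hM : MultP 2 n κ c) (hI : Isol 2 n κ c)
    (he : milnorEmbDim 2 n κ c = 2) (hM' : MultP 2 n κ (step 2 n κ i τ c)) :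
    Isol 2 n κ (step 2 n κ i τ c) ↔ milnorHilbertTwo 2 n κ c ≤ 2 := by
  constructor
  · intro hI'
    by_contra hh
    have hr := milnorHilbertTwo_range hM he
    have h3 : milnorHilbertTwo 2 n κ c = 3 := by omega
    exact hypersurface_not_isol_step_of_milnorHilbertTwo_eq_three c i τ hM he h3 hM' hI'
  · intro hh
    exact (hypersurface_isol_step_of_milnorHilbertTwo_le_two c i τ hM hI he hh hM').1

/-- [OURS · L1 W4.6 rung (ii) at `p = 2`, every dimension; NOT a statement of the manuscript]
**THE COMPLETE ONE-STEP CRITERION** (hypersurface double points `z² = a(u₁,…,uₙ)`, any field of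
characteristic `2`, any `n`): for an ISOLATED double state `c` and any chart `i`, translation `τ`
whose successor `step i τ c` is again a double point,
**the successor is ISOLATED iff `e(c) ≤ 1`, or `e(c) = 2` and `h₂(c) ≤ 2`** —
the embedding dimension `e = dim 𝔪_A/𝔪_A²` and the next Hilbert value `h₂ = dim 𝔪_A²/𝔪_A³` of the
Milnor algebra `A = κ⟦u⟧/(∂a)` decide whether the point blow-up keeps the singularity isolated
(gen 3's `hypersurface_trichotomy` for `e ≤ 1` / `e ≥ 3`; this file for `e = 2`). In words: the
next double point is isolated iff, after splitting off all hyperbolic pairs `u_ju_l` of the cleaned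
quadratic form, at most a plane germ remains and, if one does remain, it has order exactly three
modulo squares. [cite: GreuelPfister2026, Thm 3.5 and Cor 3.7] -/
theorem hypersurface_isol_step_iff [CharP κ 2] (c : (Fin n → ℕ) → κ) (i : Fin n) (τ : Fin n → κ)
    (hM : MultP 2 n κ c) (hI : Isol 2 n κ c) (hM' : MultP 2 n κ (step 2 n κ i τ c)) :
    Isol 2 n κ (step 2 n κ i τ c) ↔
      milnorEmbDim 2 n κ c ≤ 1 ∨ (milnorEmbDim 2 n κ c = 2 ∧ milnorHilbertTwo 2 n κ c ≤ 2) := by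
  have htri := hypersurface_trichotomy c i τ hM hI hM'
  rcases Nat.lt_or_ge (milnorEmbDim 2 n κ c) 2 with h1 | h2
  · exact ⟨fun _ => Or.inl (by omega), fun _ => htri.1 (by omega)⟩
  · rcases Nat.eq_or_lt_of_le h2 with h2' | h3
    · rw [hypersurface_isol_step_iff_of_milnorEmbDim_eq_two c i τ hM hI h2'.symm hM']
      constructor
      · exact fun hh => Or.inr ⟨h2'.symm, hh⟩
      · rintro (h | ⟨-, hh⟩)
        · omega
        · exact hh
    · constructor
      · exact fun hI' => absurd hI' (htri.2 (by omega))
      · rintro (h | ⟨h, -⟩) <;> omega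

end States

end CampaignW46.HypersurfacesCharTwo

end Summit.ResolutionOfSingularities.ResolutionOfSingularities.Theorems

end
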